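import Summits.CriticalPhenomena.PercolationContinuityZ3.Theorems.Transplant.FKConnectivityAllQAntipodalX2WordsPartner
import HarnessLib

/-!
# Connectivity correlation inequalities for `φ_{w,q}` — the TYPE-WORD MODEL of `X2`, file 7: THEOREM A, generic case,
# involution (memo g13 Lemmas 3.4–3.5): `ruleN (ι x) = ruleN x`

Helper file (`--supports stmt-CriticalPhenomena-4575`), FK sub-lane `prim-bschramm-fk-2` (gen 13); builds on p205010 (kernel
theorem, internal audit signed; external expert review pending).  Pure finite combinatorics on the type-word model of
`…AntipodalX2Words` (memo `bschramm/FROM-fk-2-g13-WORD-HALL.md`).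
MAIN RESULT `ruleN_iota_generic`: for a loser `x` whose hull part has two nonempty rows ("generic"), the partner `ι x` of RULE N has
the same window as `x`.  Proof: `partner_left/right` locate the hull of `ι x` and its first/last visible kinds; the hull part of `ι x`
has two nonempty rows (`rowA_hullPart_ne_nil_of_firstA`, … , or it is the whole swapped middle), so `ι x` is generic
(`isSoliton_false_of_rows_ne_nil`) and RULE N takes the generic branch on it; its balance flags are `true` exactly at the untrimmed
ends, which puts the window back to `[s*, t*]`.  With `swapWin_swapWin` and `iota_generic_valid` (file 5): on generic losers `ι` is
a level-preserving involution whose fixed windows contain the supports — the generic part of WORD-HALL (memo §1.2–1.3).  The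
soliton and ground words (memo §4) are the object of the next file.
[cite: Grimmett2006, §3.9 (p. 63)]
-/

namespace Summit.CriticalPhenomena.PercolationContinuityZ3.Theorems

namespace FK

namespace X2Word

/-! ### Row witnesses at the hull ends of a word -/

section Witness

variable {k₀ : Kind} {z : List Ty} {p p' : ℕ}

/-- If the first `A`-visible block from the hull start is a particle, row `A` of the hull part is nonempty. [folklore] -/
theorem rowA_hullPart_ne_nil_of_firstA (hs : hullStart z = some p) (he : hullEnd z = some p')
    (hf : firstA k₀ z p = some .P) : rowA (kindAt k₀ p) ((z.drop p).take (p' + 1 - p)) ≠ [] := by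
  intro h0
  obtain ⟨-, -, hzd⟩ := hull_decomp hs he
  unfold firstA at hf
  have hd : z.drop p = (z.drop p).take (p' + 1 - p) ++ List.replicate (z.length - 1 - p') .E := by
    conv_lhs => rw [hzd]
    rw [List.append_assoc, List.drop_left' (by simp)]
  rw [hd, rowA_append, h0, List.nil_append] at hf
  have := rowA_ground_allW _ _ _ (List.mem_of_head? hf)   -- hmm: head? = some P gives P ∈ list
  exact absurd this (by decide)

/-- If the first `B`-visible block from the hull start is a wall, row `B` of the hull part is nonempty. [folklore] -/
theorem rowB_hullPart_ne_nil_of_firstB (hs : hullStart z = some p) (he : hullEnd z = some p')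
    (hf : firstB k₀ z p = some .W) : rowB (kindAt k₀ p) ((z.drop p).take (p' + 1 - p)) ≠ [] := by
  intro h0
  obtain ⟨-, -, hzd⟩ := hull_decomp hs he
  unfold firstB at hf
  have hd : z.drop p = (z.drop p).take (p' + 1 - p) ++ List.replicate (z.length - 1 - p') .E := by
    conv_lhs => rw [hzd]
    rw [List.append_assoc, List.drop_left' (by simp)]
  rw [hd, rowB_append, h0, List.nil_append] at hf
  have := rowB_ground_allP _ _ _ (List.mem_of_head? hf)
  exact absurd this (by decide)

/-- If the last `A`-visible block up to the hull end is a particle, row `A` of the hull part is nonempty. [folklore] -/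
theorem rowA_hullPart_ne_nil_of_lastA (hs : hullStart z = some p) (he : hullEnd z = some p')
    (hf : lastA k₀ z p' = some .P) : rowA (kindAt k₀ p) ((z.drop p).take (p' + 1 - p)) ≠ [] := by
  intro h0
  obtain ⟨hle, hh', hzd⟩ := hull_decomp hs he
  unfold lastA at hf
  have ht : z.take (p' + 1) = List.replicate p .E ++ (z.drop p).take (p' + 1 - p) := by
    conv_lhs => rw [hzd]
    rw [List.take_left' (by simp; omega)]
  rw [ht, rowA_append, List.length_replicate, h0, List.append_nil] at hf
  have := rowA_ground_allW _ _ _ (List.mem_of_getLast? hf)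
  exact absurd this (by decide)

/-- If the last `B`-visible block up to the hull end is a wall, row `B` of the hull part is nonempty. [folklore] -/
theorem rowB_hullPart_ne_nil_of_lastB (hs : hullStart z = some p) (he : hullEnd z = some p')
    (hf : lastB k₀ z p' = some .W) : rowB (kindAt k₀ p) ((z.drop p).take (p' + 1 - p)) ≠ [] := by
  intro h0
  obtain ⟨hle, hh', hzd⟩ := hull_decomp hs he
  unfold lastB at hf
  have ht : z.take (p' + 1) = List.replicate p .E ++ (z.drop p).take (p' + 1 - p) := by
    conv_lhs => rw [hzd]
    rw [List.take_left' (by simp; omega)]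
  rw [ht, rowB_append, List.length_replicate, h0, List.append_nil] at hf
  have := rowB_ground_allP _ _ _ (List.mem_of_getLast? hf)
  exact absurd this (by decide)

/-- `· == some P` on `head?` is `headP`. [folklore] -/
theorem head?_beq_P (l : List Kind) : (l.head? == some .P) = headP l := by
  unfold headP
  rcases l.head? with _ | a
  · rfl
  · cases a <;> rfl

/-- `· == some P` on `getLast?` is `lastP`. [folklore] -/
theorem getLast?_beq_P (l : List Kind) : (l.getLast? == some .P) = lastP l := by
  unfold lastP
  rcases l.getLast? with _ | a
  · rfl
  · cases a <;> rfl

end Witness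

/-! ### THEOREM A, generic case: RULE N is an involution (memo g13 Lemmas 3.4–3.5) -/

section Involution

variable {k₀ : Kind} {x : List Ty} {h h' : ℕ}

/-- **Theorem A, generic case, involution half (memo g13 Lemmas 3.4–3.5).**  For a loser `x` whose hull part has two nonempty rows,
the partner `ι x` has the same RULE-N window as `x`: `ruleN (ι x) = ruleN x`.  With `swapWin_swapWin` this makes `ι` an involution on
generic losers, and with `iota_generic_valid` the map `w ↦ σ(ι w)` is an injective, level-preserving, window-respecting assignment of
winners to generic losers (WORD-HALL on the generic part). [folklore] -/
theorem ruleN_iota_generic (hx : isLoser k₀ x = true) (hs : hullStart x = some h) (he : hullEnd x = some h')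
    {hp : List Ty} (hhp : hp = (x.drop h).take (h' + 1 - h))
    (hA : rowA (kindAt k₀ h) hp ≠ []) (hB : rowB (kindAt k₀ h) hp ≠ []) :
    ruleN k₀ (iota k₀ x) = ruleN k₀ x := by
  obtain ⟨hxd, hlen, hle, hh', hbL, hbR, hL, hR⟩ := generic_end_facts hx hs he hhp hA hB
  obtain ⟨-, -, hX, ⟨hmA, hmB, hhead, hlast⟩, -, -⟩ := generic_window_valid hx hs he hhp hA hB
  obtain ⟨-, hne, hcons, hsnoc⟩ := hullPart_spec' hs he hhp
  have hsol := isSoliton_false_of_rows_ne_nil' hs he hhp hA hB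
  have hz := iota_generic_eq hx hs he hhp hA hB
  rw [ruleN_generic hs he hsol]
  -- freeze the flags and the kind
  generalize hbl : balancedL k₀ x h = bL at hX hL hbL hz hmA hmB hhead hlast
  generalize hbr : balancedR k₀ x h' = bR at hX hR hbR hz hmA hmB hhead hlast
  generalize hk : kindAt k₀ h = k at hA hB hbL hbR hL hR
  generalize hsd : (if bL then h else h - 1) = s at hX hz hmA hmB hhead hlast
  generalize hbd : (if bR then x.length - 1 - h' else x.length - 2 - h') = b at hX hz
  generalize hzd : iota k₀ x = z at hz
  -- balance facts in usable form
  have hLt : bL = true → headP (rowA k hp) = headP (rowB k hp) := by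
    intro hb; rw [hb] at hbL
    revert hbL; cases headP (rowA k hp) <;> cases headP (rowB k hp) <;> decide
  have hRt : bR = true → lastP (rowA k hp) = lastP (rowB k hp) := by
    intro hb; rw [hb] at hbR
    revert hbR; cases lastP (rowA k hp) <;> cases lastP (rowB k hp) <;> decide
  have hkk : (if bL then kindAt k₀ s else (kindAt k₀ s).other) = k := by
    cases hb : bL
    · have h1 := (hL hb).1
      rw [hb] at hsd; simp only [Bool.false_eq_true, if_false] at hsd ⊢
      rw [← hsd, kindAt_pred h1, hk, Kind.other_other]
    · rw [hb] at hsd; simp only [if_true] at hsd ⊢; rw [← hsd, hk]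
  -- the two ends of hp
  obtain ⟨e₀, hp₁, hpe⟩ := List.exists_cons_of_ne_nil hne
  have he₀ : e₀ ≠ .E := hcons e₀ hp₁ hpe
  obtain ⟨hq₁, e₁, hpe'⟩ : ∃ l e, hp = l ++ [e] := by
    rcases List.eq_nil_or_concat hp with h0 | ⟨l, e, hel⟩
    · exact absurd h0 hne
    · exact ⟨l, e, by rw [hel, List.concat_eq_append]⟩
  have he₁ : e₁ ≠ .E := hsnoc hq₁ e₁ hpe'
  -- the partner's ends
  have hmidL : midOf bL bR hp = (if bL then [] else [Ty.E]) ++ (e₀ :: hp₁) ++ (if bR then [] else [Ty.E]) := by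
    rw [midOf, hpe]
  have hmidR : midOf bL bR hp = (if bL then [] else [Ty.E]) ++ (hq₁ ++ [e₁]) ++ (if bR then [] else [Ty.E]) := by
    rw [midOf, hpe']
  obtain ⟨hzs, hLtrim, hLno⟩ := partner_left (k₀ := k₀) s b bL k e₀ he₀ hp₁ (if bR then [] else [Ty.E]) (midOf bL bR hp) z
    hmidL hz hkk (hpe ▸ hA) (hpe ▸ hB) (fun hb => hpe ▸ hLt hb) hmA hmB
  have hkL : kindAt (kindAt k₀ s) (if bL then [] else [Ty.E]).length = k := by
    cases bL <;> simp [kindAt] at hkk ⊢ <;> exact hkk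
  obtain ⟨hze, hRtrim, hRno⟩ := partner_right (k₀ := k₀) s b bR k (kindAt k hq₁.length) e₁ he₁ hq₁ (if bL then [] else [Ty.E])
    (midOf bL bR hp) z hmidR hz hkL rfl (hpe' ▸ hA) (hpe' ▸ hB) (fun hb => hpe' ▸ hRt hb) hmA hmB
  -- lengths
  have hml : (midOf bL bR hp).length = (if bL then 0 else 1) + (h' + 1 - h) + (if bR then 0 else 1) := by
    rw [length_midOf, hlen]
  have hs_le : (if bL then h else h - 1) = s := hsd
  have hLtrim2 : (bL && decide (e₀ = Ty.F)) = true → 2 ≤ hp.length := by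
    intro ht
    obtain ⟨hb1, he⟩ := Bool.and_eq_true_iff.mp ht
    have he : e₀ = .F := of_decide_eq_true he
    subst hb1 he
    cases hq : k with
    | W => rw [hq] at hA hLt; obtain ⟨hp₂, h1, -⟩ := balF_head_W (hpe ▸ hA) (hpe ▸ hLt rfl); rw [hpe, h1]; simp
    | P => rw [hq] at hB hLt; obtain ⟨hp₂, h1, -⟩ := balF_head_P (hpe ▸ hB) (hpe ▸ hLt rfl); rw [hpe, h1]; simp
  have hRtrim2 : (bR && decide (e₁ = Ty.F)) = true → 2 ≤ hp.length := by
    intro ht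
    obtain ⟨hb1, he⟩ := Bool.and_eq_true_iff.mp ht
    have he : e₁ = .F := of_decide_eq_true he
    subst hb1 he
    cases hq : kindAt k hq₁.length with
    | W => obtain ⟨hp₂, h1, -⟩ := balF_last_W hq (hpe' ▸ hA) (hpe' ▸ hRt rfl); rw [hpe', h1]; simp
    | P => obtain ⟨hp₂, h1, -⟩ := balF_last_P hq (hpe' ▸ hB) (hpe' ▸ hRt rfl); rw [hpe', h1]; simp
  -- the hull of z and the generic branch for z
  set hz₀ := (if (bL && decide (e₀ = Ty.F)) then s + 1 else s) with hz₀d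
  set hz₁ := (if (bR && decide (e₁ = Ty.F)) then s + (midOf bL bR hp).length - 2 else s + (midOf bL bR hp).length - 1)
    with hz₁d
  have hkz : kindAt k₀ hz₀ = (if (bL && decide (e₀ = Ty.F)) then (kindAt k₀ s).other else kindAt k₀ s) := by
    rw [hz₀d]; split_ifs <;> simp [kindAt_succ]
  -- rows of the hull part of z are nonempty
  have hHZ : (bL && decide (e₀ = Ty.F)) = false → (bR && decide (e₁ = Ty.F)) = false →
      (z.drop hz₀).take (hz₁ + 1 - hz₀) = (midOf bL bR hp).map Ty.swap := by
    intro ht ht'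
    have h0 : hz₀ = s := by rw [hz₀d, ht]; rfl
    have h1 : hz₁ = s + (midOf bL bR hp).length - 1 := by rw [hz₁d, ht']; rfl
    rw [h0, h1, hz, List.append_assoc, List.drop_left' (by simp),
      show s + (midOf bL bR hp).length - 1 + 1 - s = ((midOf bL bR hp).map Ty.swap).length by simp; omega,
      List.take_left]
  have hzA : rowA (kindAt k₀ hz₀) ((z.drop hz₀).take (hz₁ + 1 - hz₀)) ≠ [] := by
    cases ht : (bL && decide (e₀ = Ty.F)) with
    | true =>
      have h0 : hz₀ = s + 1 := by rw [hz₀d, ht]; rfl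
      exact rowA_hullPart_ne_nil_of_firstA hzs hze (by rw [h0]; exact (hLtrim ht).1)
    | false =>
      cases ht' : (bR && decide (e₁ = Ty.F)) with
      | true =>
        have h1 : hz₁ = s + (midOf bL bR hp).length - 2 := by rw [hz₁d, ht']; rfl
        exact rowA_hullPart_ne_nil_of_lastA hzs hze (by rw [h1]; exact (hRtrim ht').1)
      | false =>
        have h0 : hz₀ = s := by rw [hz₀d, ht]; rfl
        rw [hHZ ht ht', rowA_map_swap, h0]; exact hmB
  have hzB : rowB (kindAt k₀ hz₀) ((z.drop hz₀).take (hz₁ + 1 - hz₀)) ≠ [] := by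
    cases ht : (bL && decide (e₀ = Ty.F)) with
    | true =>
      have h0 : hz₀ = s + 1 := by rw [hz₀d, ht]; rfl
      exact rowB_hullPart_ne_nil_of_firstB hzs hze (by rw [h0]; exact (hLtrim ht).2)
    | false =>
      cases ht' : (bR && decide (e₁ = Ty.F)) with
      | true =>
        have h1 : hz₁ = s + (midOf bL bR hp).length - 2 := by rw [hz₁d, ht']; rfl
        exact rowB_hullPart_ne_nil_of_lastB hzs hze (by rw [h1]; exact (hRtrim ht').2)
      | false =>
        have h0 : hz₀ = s := by rw [hz₀d, ht]; rfl
        rw [hHZ ht ht', rowB_map_swap, h0]; exact hmA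
  have hzsol := isSoliton_false_of_rows_ne_nil hzs hze hzA hzB
  rw [ruleN_generic hzs hze hzsol]
  have ht_eq : s + (midOf bL bR hp).length - 1 = (if bR then h' else h' + 1) := by
    rw [hml, ← hs_le]
    cases bL <;> cases bR <;> simp at hL hR ⊢ <;> omega
  have hc : ((some Kind.P == some Kind.P) == (some Kind.W == some Kind.P)) = false := by decide
  -- the balance flags of z
  congr 1
  ext1
  · -- left
    unfold balancedL
    cases ht : (bL && decide (e₀ = Ty.F)) with
    | true =>
      have h0 : hz₀ = s + 1 := by rw [hz₀d, ht]; rfl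
      obtain ⟨f1, f2⟩ := hLtrim ht
      rw [h0, f1, f2, hc]
      simp only [Bool.false_eq_true, if_false, Nat.add_sub_cancel]
    | false =>
      have h0 : hz₀ = s := by rw [hz₀d, ht]; rfl
      obtain ⟨f1, f2⟩ := hLno ht
      rw [h0, f1, f2, head?_beq_P, head?_beq_P, ← hhead, beq_self_eq_true]
      simp only [if_true]
  · -- right
    unfold balancedR
    cases ht : (bR && decide (e₁ = Ty.F)) with
    | true =>
      have h1 : hz₁ = s + (midOf bL bR hp).length - 2 := by rw [hz₁d, ht]; rfl
      obtain ⟨f1, f2⟩ := hRtrim ht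
      have h2 := hRtrim2 ht
      obtain ⟨hb1, -⟩ := Bool.and_eq_true_iff.mp ht
      subst hb1
      rw [h1, f1, f2, hc]
      simp only [Bool.false_eq_true, if_false, if_true] at ht_eq ⊢
      rw [hml] at ht_eq ⊢
      omega
    | false =>
      have h1 : hz₁ = s + (midOf bL bR hp).length - 1 := by rw [hz₁d, ht]; rfl
      obtain ⟨f1, f2⟩ := hRno ht
      rw [h1, f1, f2, getLast?_beq_P, getLast?_beq_P, ← hlast, beq_self_eq_true]
      simp only [if_true]
      all_goals exact ht_eq

end Involution

end X2Word

end FK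

end Summit.CriticalPhenomena.PercolationContinuityZ3.Theorems
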